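import Literature.IUT.LogThetaLattice.PerpPrimeStrips
import Literature.IUT.HodgeArakelov.RealifiedDataDegreeTorsor
import Mathlib.CategoryTheory.SingleObj
import HarnessLib

/-!
# [IUTchIII] Definition 2.4 (iii) / [IUTchI] Definition 5.2 (iv): the frame `GlobalRealifiedFrame` is INHABITED
# by the skeletal degree model (non-vacuity witness, L6 row «NV-L6 GlobalRealifiedFrame»)

S. Mochizuki, *Inter-universal Teichmüller theory III*, kurims manuscript (May 2020), §2, Def. 2.4 (iii) pp. 88–89,
over [IUTchI] Def. 5.2 (iv) p. 135 ((a) `*C^⊩` a category isomorphic to the model `C^⊩_mod`, (c) a bijection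
`Prime(*C^⊩) ⥲ V̲`, (e) isomorphisms of topological monoids `*ρ_v : Φ_{*C^⊩,v} ⥲ Φ^{rlf}_{*F_v}`, both `≅ ℝ_{≥0}`) and
[IUTchII] Cor. 4.10 (v) p. 161 (the `ℝ_{>0}`-orbits "obtained by multiplying the arithmetic degrees by a given element
`∈ ℝ_{>0}` [cf. [FrdI], Example 6.3; [FrdI], Theorem 6.4, (ii); [IUTchI], Remark 3.1.5]"). [claim: Mochizuki2012, status:
disputed] for every quoted sentence.

PROOF-ONLY file (abc-iut cell, layer L6, seat abc-iut-w5-d112; L6-lead §F v1.18p «NV-L6 WAVE», w5-d114's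
INHABITATION-CENSUS-L6-v3 §A: `GlobalRealifiedFrame` had ZERO producers). No definition, no instance: the witness is built
inside the theorem term from Mathlib's one-object groupoids.

THE MODEL (SKELETAL — equivalent, not equal, to the groupoids of record). abc-iut-L6-t3's STUB frame
`GlobalRealifiedFrame V Str` asks for: `GR` = the groupoid of `V̲`-labelled global realified Frobenioids with
LABEL-PRESERVING isomorphisms, `TM` = topological monoids `≅ ℝ_{≥0}` with their isomorphisms, and the functors
`Φ : GR ⥤ (V̲ → TM)` (divisor monoid at the prime labelled `v`), `Φ^{rlf} : Str ⥤ (V̲ → TM)` (realified monoid of the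
`v`-component of a strip). In the cell's coordinates of record (abc-iut-w4-d009, `RealifiedDataDegreeTorsor.lean`, [IUTchII]
Cor. 4.5 (ii)/4.6 (ii)/4.10 (v)): any two labelled data are isomorphic (`RlfData.hom_nonempty`) and every Hom-set is an
`ℝ_{>0}`-TORSOR, a morphism being determined by its DEGREE `deg > 0` ([FrdI] Thm. 6.4 (ii)), ONE scalar for all `v`
(`RlfData.degEquiv`, `RlfData.Hom.ext_of_deg_eq`); likewise the automorphisms of the topological monoid `ℝ_{≥0}` are the
dilations by `ℝ_{>0}`. Hence BOTH groupoids are equivalent to the ONE-OBJECT groupoid with automorphism group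
`ℝ_{>0} ≅ (ℝ, +)` (log-coordinates): `SingleObj (Multiplicative ℝ)`. In this skeleton:
* `Φ` := the DIAGONAL functor (an isomorphism of degree `d` multiplies EVERY local divisor monoid `Φ_{*C^⊩,v} ≅ ℝ_{≥0}` by
  the same `d` — w4-d009's "ONE scalar for all `v`");
* `Φ^{rlf}` := the functor sending every strip to the family of monoids and every isomorphism of strips to the IDENTITY
  dilation — genuinely right for prime-strips: an isomorphism of the `v`-components carries the distinguished element
  (`log(p_v)` / the Frobenius element) to the distinguished element, and the pointed rank-one line admits a UNIQUE such
  isomorphism (abc-iut-L4-t3 / w4-d009 `RLine.eq_frobIso_of_map_frob`, [IUTchII] Prop. 4.2 (ii)), i.e. degree `1` on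
  `Φ^{rlf}_{*F_v}`; the theorem is stated for an ARBITRARY strip category `Str` (the frame's parameter), the intended
  instances being abc-iut-L6-t3's `FvStrip` / `FperpStrip` / `FtriStrip`.

HONEST LABEL: SKELETAL MODEL — the carriers `GR`, `TM` are one-object skeleta (equivalent to, not literally, the groupoid
`RlfData V` of record and the groupoid of monoids `≅ ℝ_{≥0}`), with the genuine automorphism group `ℝ_{>0}` and the genuine
(diagonal / trivial) actions; it is NOT the degenerate witness (which would take trivial automorphism groups). Universe: the
frame is inhabited at object-universe `0` (Mathlib's `SingleObj` lives in `Type`). Nothing here asserts anything about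
[IUTchIII] Cor. 3.12 or takes a side; inhabited ≠ endorsed.
-/

namespace Literature.IUT.LogThetaLattice

open CategoryTheory

universe w

/-- **`GlobalRealifiedFrame` is inhabited by the skeletal degree model**: `GR = TM = B ℝ_{>0}`
(`SingleObj (Multiplicative ℝ)`, log-coordinates of the degree torsor of abc-iut-w4-d009's `RlfData`), `Φ` the diagonal
functor ("one scalar for all `v`"), `Φ^{rlf}` trivial on isomorphisms of strips (rigidity of the pointed realified
monoids, `RLine.eq_frobIso_of_map_frob`), for every label type `V` and every strip category `Str`.
[claim: Mochizuki2012, status: disputed] -/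
theorem GlobalRealifiedFrame.nonempty_model (V : Type w) (Str : Type w) [Category.{w} Str] :
    Nonempty (GlobalRealifiedFrame.{0, w} V Str) :=
  ⟨{ GR := SingleObj (Multiplicative ℝ)
     TM := SingleObj (Multiplicative ℝ)
     Φ := Functor.pi' fun _ : V => 𝟭 (SingleObj (Multiplicative ℝ))
     Φrlf := Functor.pi' fun _ : V =>
       (Functor.const Str).obj (SingleObj.star (Multiplicative ℝ)) }⟩

end Literature.IUT.LogThetaLattice
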